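import Summits.Ventures.YMGap.RobustBall.EnergyVarianceTorus
import Summits.Ventures.YMGap.RobustBall.SparseParitySet
import Summits.Ventures.YMGap.RobustBall.HaarSecondMoments
import Literature.MathematicalPhysics.QuantumFieldTheory.Balaban1983to89.InfiniteVolumeSufficientIII
import Summits.Ventures.YMGap.RobustBall.MemberPressure
import HarnessLib

/-!
# Robust ball (Y2), strong-coupling laws — THE FREE ENERGY DENSITY IS STRONGLY CONVEX IN THE COUPLING, explicit modulus, every
# `SU(N)`, every dimension, every coupling

HONEST FRAMING: venture file of the cell `pub-ymgap` (QuantumFields programme), track ROBUST-BALL, seat rb-p2 (g8).  LATTICE statements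
about Wilson's lattice gauge theory for a special unitary model `ρ` (`G ≅ SU(N)`, `N ≥ 2`) on the tori `(ℤ/(L+1)ℤ)^d`, `d ≥ 2`, and its
infinite-volume free energy density `f = freeEnergyDensity d ρ` (tree: the limit of `|Λ_{L+1}|⁻¹ log Z_{Λ_{L+1},β}`, which exists and is
CONVEX, `convexOn_freeEnergyDensity`).  Nothing here is about the continuum, a spectral gap or the Clay problem; the modulus is a
one-link / private-link artefact, not a physical susceptibility.

MAIN RESULT (`strongConvexOn_freeEnergyDensity`).  For every `b`, on the coupling segment `[−b, b]` the free energy density is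
STRONGLY convex with modulus

  `m(b) = (1/2) · V₀ · e^{−8(d−1)N b}`,   `V₀ = charVariance ρ = ∫ (Re tr ρ)² dHaar` (`= 1` for `SU(2)`, `1/2` for `SU(N ≥ 3)`),

i.e. `t ↦ f(t) − (m(b)/2) t²` is convex on `[−b, b]` (`StrongConvexOn (Icc (−b) b) (m b) f`).  The tree's `convexOn_freeEnergyDensity` is
the case `m = 0`; strict convexity of `f` (`strictConvexOn_freeEnergyDensity`) follows.  Cells: `SU(2)`, `d = 4`: `m(b) = e^{−48 b}/2`
(`su2_strongConvexOn_freeEnergyDensity_dim4`).  (True curvature at `β = 0`: `#planes · V₀`, e.g. `f''(0) = 6` for `SU(2)`, `d = 4` — seat ds-1.)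

MECHANISM.  (i) At finite volume the torus pressure `p_L(t) = |Λ|⁻¹ log Z_{Λ,t}` is the normalised cumulant generating function of `−S_W`
under product Haar measure (module III `torusLogPartition_eq_cgf`), so `p_L'' = |Λ|⁻¹ Var_{μ_{Λ,t}}(S_W)` (Mathlib `variance_tilted_mul`);
(ii) the extensive energy-variance floor `Var_{μ_{Λ,t}}(S_W) ≥ |S_L| e^{−8(d−1)N|t|} V₀` of `EnergyVarianceTorus` (inverse Efron–Stein +
private-link resampling) on the checkerboard site set `S_L = {x : x_k ≠ −1 (k ≠ 0), Σ_{k≠0} val x_k even}` of density `→ 1/2`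
(`SparseParitySet`) makes `p_L − (m_L/2)t²` convex on `[−b, b]` with `m_L → m(b)`; (iii) convexity passes to the pointwise limit `p_L → f`
(`tendsto_cgf_negWilsonAction`).

References: S. Friedli, Y. Velenik, *Statistical Mechanics of Lattice Systems* (2017), §3.2 and Thm. B.12; E. Seiler, LNP 159 (1982),
Ch. 2.  Everything here is proved; no definition, no named fact. [folklore]
-/

noncomputable section

open MeasureTheory ProbabilityTheory Finset Function Filter Topology Set
open Literature.MathematicalPhysics.QuantumLattice Literature.MathematicalPhysics.QuantumFieldTheory

namespace Summit.Ventures.YMGap.RobustBall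

namespace EnergyVariance

/-! ### Part C — strong convexity of the torus pressures and of the free energy density -/

section FreeEnergy

variable {d N : ℕ} {G : Type*} [Group G] [TopologicalSpace G] [IsTopologicalGroup G] [CompactSpace G]
  [MeasurableSpace G] [BorelSpace G] [SecondCountableTopology G] (ρ : G →* Matrix (Fin N) (Fin N) ℂ)

/-- ★★ **FINITE-VOLUME SPECIFIC-HEAT FLOOR** (checkerboard set): for `G ≅ SU(N)`, `N ≥ 2`, `d ≥ 2`, every torus side `n = L + 1 ≥ 2` and every
real `β`, `Var_{μ_{Λ_{L+1},β}}(S_W) ≥ (n(n−1)^{d−1}/2) · e^{−8(d−1)N|β|} · V₀` — the energy variance per site is bounded below uniformly in the volume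
(the checkerboard sites off the `0`-th axis carry the direction-`0` links of `EnergyVarianceTorus`; `SparseParitySet`). [folklore] -/
theorem sparse_floor_le_variance_wilsonAction (hρ : IsSpecialUnitaryModel ρ) (hN : 2 ≤ N) (hd : 2 ≤ d) {L : ℕ} (hL : 1 ≤ L) (β : ℝ) :
    (((L + 1 : ℕ) : ℝ) * (((L + 1 : ℕ) : ℝ) - 1) ^ (d - 1) / 2) * Real.exp (-(8 * (d - 1 : ℕ) * N * |β|)) *
        PlaquetteLowerBound.charVariance ρ ≤
      Var[wilsonAction (d := d) (L := L + 1) (G := G) ρ; wilsonMeasure (d := d) (L := L + 1) ρ β] := by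
  classical
  set i : Fin d := ⟨0, by omega⟩ with hi
  set j : Fin d := ⟨1, by omega⟩ with hj
  have hij : i < j := Fin.mk_lt_mk.2 (by norm_num)
  set S : Finset (Site d (L + 1)) := (Fintype.piFinset fun k : Fin d => if k = i then (Finset.univ : Finset (ZMod (L + 1))) else
      (Finset.univ : Finset (ZMod (L + 1))).erase (((L + 1 - 1 : ℕ) : ZMod (L + 1)))).filter
      (fun x => Even (∑ k ∈ Finset.univ.erase i, (x k).val)) with hS
  have hSsparse : ∀ x ∈ S, ∀ x' ∈ S, ∀ k : Fin d, k ≠ i → x' ≠ x.shift k :=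
    fun x hx x' hx' k hk => sparse_paritySet (by omega) i hx hx' k hk
  have hScard : ((L + 1 : ℕ) : ℝ) * (((L + 1 : ℕ) : ℝ) - 1) ^ (d - 1) ≤ 2 * (S.card : ℝ) := two_mul_card_paritySet_ge i
  have hK : 0 ≤ Real.exp (-(8 * (d - 1 : ℕ) * N * |β|)) * PlaquetteLowerBound.charVariance ρ :=
    mul_nonneg (Real.exp_pos _).le (PlaquetteLowerBound.charVariance_pos ρ hρ.1 (by omega)).le
  have hfloor := card_mul_le_variance_wilsonAction' ρ hρ hN (by omega) hij S hSsparse β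
  calc (((L + 1 : ℕ) : ℝ) * (((L + 1 : ℕ) : ℝ) - 1) ^ (d - 1) / 2) * Real.exp (-(8 * (d - 1 : ℕ) * N * |β|)) *
        PlaquetteLowerBound.charVariance ρ
      ≤ (S.card : ℝ) * Real.exp (-(8 * (d - 1 : ℕ) * N * |β|)) * PlaquetteLowerBound.charVariance ρ := by
        rw [mul_assoc, mul_assoc (S.card : ℝ)]
        exact mul_le_mul_of_nonneg_right (by linarith) hK
    _ ≤ _ := hfloor

/-- The same floor for the variance of `−S_W` under the product Haar measure tilted by `t(−S_W)` (= the torus Wilson state at coupling `t`,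
the form in which the cumulant generating function is differentiated). [folklore] -/
theorem sparse_floor_le_variance_tilted (hρ : IsSpecialUnitaryModel ρ) (hN : 2 ≤ N) (hd : 2 ≤ d) {L : ℕ} (hL : 1 ≤ L) (t : ℝ) :
    (((L + 1 : ℕ) : ℝ) * (((L + 1 : ℕ) : ℝ) - 1) ^ (d - 1) / 2) * Real.exp (-(8 * (d - 1 : ℕ) * N * |t|)) *
        PlaquetteLowerBound.charVariance ρ ≤
      Var[fun U : GaugeConfig d (L + 1) G => -wilsonAction ρ U;
        (Measure.pi fun _ : Edge d (L + 1) => haarProbability G).tilted fun U => t * -wilsonAction ρ U] := by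
  have htilt : ((Measure.pi fun _ : Edge d (L + 1) => haarProbability G).tilted
      fun U : GaugeConfig d (L + 1) G => t * -wilsonAction ρ U) = wilsonMeasure (d := d) (L := L + 1) ρ t := by
    rw [wilsonMeasure_eq_tilted_pi ρ hρ.1 t]
    congr 1
    funext U
    ring
  rw [htilt, variance_fun_neg]
  exact sparse_floor_le_variance_wilsonAction ρ hρ hN hd hL t

/-- ★★ **`SU(2)`, `d = 4`, finite volume**: `Var_{Λ_{L+1}, β_W/2}(S_W) ≥ ((L+1)L³/2) · e^{−24|β_W|}` for every `L ≥ 1` and every real `β_W`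
(tree coupling `β_W/2`, `V₀ = 1`). [folklore] -/
theorem su2_variance_wilsonAction_ge_dim4 {L : ℕ} (hL : 1 ≤ L) (βW : ℝ) :
    (((L + 1 : ℕ) : ℝ) * (((L + 1 : ℕ) : ℝ) - 1) ^ 3 / 2) * Real.exp (-(24 * |βW|)) ≤
      Var[wilsonAction (d := 4) (L := L + 1) (G := Matrix.specialUnitaryGroup (Fin 2) ℂ) (fundamentalRep (Fin 2));
        wilsonMeasure (d := 4) (L := L + 1) (fundamentalRep (Fin 2)) (βW / 2)] := by
  have h := sparse_floor_le_variance_wilsonAction (d := 4) (fundamentalRep (Fin 2)) (TorusAreaLaw.isSpecialUnitaryModel_fundamentalRep 2)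
    le_rfl (by norm_num) hL (βW / 2)
  rw [HaarSecondMoments.charVariance_su2, mul_one] at h
  have e : Real.exp (-(8 * (4 - 1 : ℕ) * (2 : ℕ) * |βW / 2|)) = Real.exp (-(24 * |βW|)) := by
    rw [abs_div, abs_of_pos (by norm_num : (0 : ℝ) < 2)]
    norm_num; ring_nf
  rw [e] at h
  exact h

/-- **Strong convexity of the torus pressures.**  For `L + 1 ≥ 2` and every `b`, the torus pressure
`p_L(t) = |Λ_{L+1}|⁻¹ log Z_{Λ_{L+1},t}` (normalised cumulant generating function of `−S_W`) satisfies: `p_L − (m_L(b)/2) t²` is convex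
on `[−b, b]`, `m_L(b) = |Λ|⁻¹ (n(n−1)^{d−1}/2) e^{−8(d−1)Nb} V₀`, `n = L + 1`. [folklore] -/
theorem convexOn_torusPressure_sub_sq (hρ : IsSpecialUnitaryModel ρ) (hN : 2 ≤ N) (hd : 2 ≤ d) {L : ℕ} (hL : 1 ≤ L) (b : ℝ) :
    ConvexOn ℝ (Set.Icc (-b) b) (fun t : ℝ =>
      (((L + 1 : ℕ) : ℝ) ^ d)⁻¹ * cgf (fun U : GaugeConfig d (L + 1) G => -wilsonAction ρ U)
          (Measure.pi fun _ : Edge d (L + 1) => haarProbability G) t -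
        ((((L + 1 : ℕ) : ℝ) ^ d)⁻¹ * ((((L + 1 : ℕ) : ℝ) * (((L + 1 : ℕ) : ℝ) - 1) ^ (d - 1) / 2) *
          Real.exp (-(8 * (d - 1 : ℕ) * N * b)) * PlaquetteLowerBound.charVariance ρ)) / 2 * t ^ 2) := by
  have hH : Measurable fun U : GaugeConfig d (L + 1) G => -wilsonAction ρ U := (measurable_wilsonAction ρ hρ.1).neg
  obtain ⟨B, hB⟩ := exists_abs_wilsonAction_le (d := d) (L := L + 1) ρ hρ.1
  have hB' : ∀ U : GaugeConfig d (L + 1) G, |-wilsonAction ρ U| ≤ B := fun U => by rw [abs_neg]; exact hB U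
  refine convexOn_mul_cgf_sub_sq hH hB' fun t ht => ?_
  have hV : 0 < (((L + 1 : ℕ) : ℝ) ^ d)⁻¹ := by positivity
  rw [Set.mem_Icc] at ht
  have habs : |t| ≤ b := abs_le.2 ⟨ht.1, ht.2⟩
  have hexp : Real.exp (-(8 * (d - 1 : ℕ) * N * b)) ≤ Real.exp (-(8 * (d - 1 : ℕ) * N * |t|)) :=
    Real.exp_le_exp.2 (by nlinarith [habs, (by positivity : (0 : ℝ) ≤ 8 * (d - 1 : ℕ) * N)])
  have hfloor := sparse_floor_le_variance_tilted ρ hρ hN hd hL t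
  have hV0 := (PlaquetteLowerBound.charVariance_pos ρ hρ.1 (by omega)).le
  have hA : 0 ≤ ((L + 1 : ℕ) : ℝ) * (((L + 1 : ℕ) : ℝ) - 1) ^ (d - 1) / 2 := by
    have : (1 : ℝ) ≤ ((L + 1 : ℕ) : ℝ) := by exact_mod_cast (show 1 ≤ L + 1 by omega)
    have h1 : (0 : ℝ) ≤ ((L + 1 : ℕ) : ℝ) - 1 := by linarith
    positivity
  calc (((L + 1 : ℕ) : ℝ) ^ d)⁻¹ * ((((L + 1 : ℕ) : ℝ) * (((L + 1 : ℕ) : ℝ) - 1) ^ (d - 1) / 2) *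
          Real.exp (-(8 * (d - 1 : ℕ) * N * b)) * PlaquetteLowerBound.charVariance ρ)
      ≤ (((L + 1 : ℕ) : ℝ) ^ d)⁻¹ * ((((L + 1 : ℕ) : ℝ) * (((L + 1 : ℕ) : ℝ) - 1) ^ (d - 1) / 2) *
          Real.exp (-(8 * (d - 1 : ℕ) * N * |t|)) * PlaquetteLowerBound.charVariance ρ) := by
        gcongr
    _ ≤ _ := mul_le_mul_of_nonneg_left hfloor hV.le

/-- ★★★ **THE FREE ENERGY DENSITY OF LATTICE YANG–MILLS IS STRONGLY CONVEX IN THE COUPLING, with an explicit modulus.**  For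
`G ≅ SU(N)` (`N ≥ 2`), `d ≥ 2` and every `b`:

  `StrongConvexOn [−b, b] ((1/2) · V₀ · e^{−8(d−1)N b}) (freeEnergyDensity d ρ)`,   `V₀ = charVariance ρ`,

i.e. `t ↦ f(t) − (1/4) V₀ e^{−8(d−1)Nb} t²` is convex on `[−b, b]`.  (Limit of the strongly convex torus pressures; the tree's
`convexOn_freeEnergyDensity` is the modulus-`0` statement.) [folklore] -/
theorem strongConvexOn_freeEnergyDensity (hρ : IsSpecialUnitaryModel ρ) (hN : 2 ≤ N) (hd : 2 ≤ d) (b : ℝ) :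
    StrongConvexOn (Set.Icc (-b) b)
      ((1 / 2 : ℝ) * Real.exp (-(8 * (d - 1 : ℕ) * N * b)) * PlaquetteLowerBound.charVariance ρ)
      (freeEnergyDensity d ρ) := by
  rw [strongConvexOn_real_iff]
  set K : ℝ := Real.exp (-(8 * (d - 1 : ℕ) * N * b)) * PlaquetteLowerBound.charVariance ρ with hK
  -- the moduli of the torus pressures and their limit
  set mL : ℕ → ℝ := fun L => (((L + 1 : ℕ) : ℝ) ^ d)⁻¹ * ((((L + 1 : ℕ) : ℝ) * (((L + 1 : ℕ) : ℝ) - 1) ^ (d - 1) / 2) *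
      Real.exp (-(8 * (d - 1 : ℕ) * N * b)) * PlaquetteLowerBound.charVariance ρ) with hmL
  have hmL' : ∀ L, mL L = ((((L + 1 : ℕ) : ℝ) * (((L + 1 : ℕ) : ℝ) - 1) ^ (d - 1)) / (2 * ((L + 1 : ℕ) : ℝ) ^ d)) * K := by
    intro L
    have hn : (((L + 1 : ℕ) : ℝ) ^ d) ≠ 0 := by positivity
    simp only [hmL, hK]
    field_simp
  have hm : Tendsto mL atTop (𝓝 ((1 / 2 : ℝ) * K)) := by
    rw [show mL = fun L => ((((L + 1 : ℕ) : ℝ) * (((L + 1 : ℕ) : ℝ) - 1) ^ (d - 1)) / (2 * ((L + 1 : ℕ) : ℝ) ^ d)) * K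
      from funext hmL']
    exact (tendsto_parity_density (by omega)).mul tendsto_const_nhds
  have hlimp := tendsto_cgf_negWilsonAction (d := d) (G := G) ρ hρ.1
  refine convexOn_of_tendsto (convex_Icc _ _)
    (p := fun L t => (((L + 1 : ℕ) : ℝ) ^ d)⁻¹ * cgf (fun U : GaugeConfig d (L + 1) G => -wilsonAction ρ U)
      (Measure.pi fun _ : Edge d (L + 1) => haarProbability G) t - mL L / 2 * t ^ 2) ?_ fun t _ => ?_
  · filter_upwards [eventually_ge_atTop 1] with L hL
    exact convexOn_torusPressure_sub_sq ρ hρ hN hd hL b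
  · have h := (hlimp t).sub ((hm.div_const 2).mul_const (t ^ 2))
    have e : (1 / 2 : ℝ) * K = (1 / 2 : ℝ) * Real.exp (-(8 * (d - 1 : ℕ) * N * b)) *
        PlaquetteLowerBound.charVariance ρ := by rw [hK]; ring
    rw [e] at h
    exact h

/-- **Strict convexity of the free energy density** on every coupling segment (hence on `ℝ`). [folklore] -/
theorem strictConvexOn_freeEnergyDensity (hρ : IsSpecialUnitaryModel ρ) (hN : 2 ≤ N) (hd : 2 ≤ d) :
    StrictConvexOn ℝ Set.univ (freeEnergyDensity d ρ) := by
  refine ⟨convex_univ, fun x _ y _ hxy a b ha hb hab => ?_⟩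
  set B : ℝ := max |x| |y| with hB
  have hx : x ∈ Set.Icc (-B) B := ⟨by rw [hB]; linarith [neg_abs_le x, le_max_left |x| |y|], (le_abs_self x).trans (le_max_left _ _)⟩
  have hy : y ∈ Set.Icc (-B) B := ⟨by rw [hB]; linarith [neg_abs_le y, le_max_right |x| |y|], (le_abs_self y).trans (le_max_right _ _)⟩
  have hsc := strongConvexOn_freeEnergyDensity ρ hρ hN hd B
  have hpos : 0 < (1 / 2 : ℝ) * Real.exp (-(8 * (d - 1 : ℕ) * N * B)) * PlaquetteLowerBound.charVariance ρ :=
    mul_pos (mul_pos (by positivity) (Real.exp_pos _)) (PlaquetteLowerBound.charVariance_pos ρ hρ.1 (by omega))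
  have hstrict := (UniformConvexOn.strictConvexOn hsc fun r hr => by positivity)
  exact hstrict.2 hx hy hxy ha hb hab

/-- ★★ **`SU(2)`, `d = 4`**: on `[−b, b]` (tree coupling `β = β_W/2`) the free energy density is strongly convex with modulus `e^{−48 b}/2`:
`t ↦ f(t) − (e^{−48b}/4) t²` is convex. [folklore] -/
theorem su2_strongConvexOn_freeEnergyDensity_dim4 (b : ℝ) :
    StrongConvexOn (Set.Icc (-b) b) (Real.exp (-(48 * b)) / 2) (freeEnergyDensity 4 (fundamentalRep (Fin 2))) := by
  have h := strongConvexOn_freeEnergyDensity (d := 4) (fundamentalRep (Fin 2)) (TorusAreaLaw.isSpecialUnitaryModel_fundamentalRep 2)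
    le_rfl (by norm_num) b
  rw [HaarSecondMoments.charVariance_su2] at h
  have e : (1 / 2 : ℝ) * Real.exp (-(8 * (4 - 1 : ℕ) * (2 : ℕ) * b)) * 1 = Real.exp (-(48 * b)) / 2 := by
    norm_num; ring_nf
  rw [e] at h
  exact h

/-- ★★ **Every `SU(N)`, `N ≥ 3`, every `d ≥ 2`**: modulus `(1/4) e^{−8(d−1)Nb}` (`V₀ = 1/2`). [folklore] -/
theorem suN_strongConvexOn_freeEnergyDensity {N : ℕ} (hN : 3 ≤ N) (hd : 2 ≤ d) (b : ℝ) :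
    StrongConvexOn (Set.Icc (-b) b) ((1 / 4 : ℝ) * Real.exp (-(8 * (d - 1 : ℕ) * N * b)))
      (freeEnergyDensity d (fundamentalRep (Fin N))) := by
  have h := strongConvexOn_freeEnergyDensity (d := d) (fundamentalRep (Fin N)) (TorusAreaLaw.isSpecialUnitaryModel_fundamentalRep N)
    (by omega) hd b
  rw [HaarSecondMoments.charVariance_suN hN] at h
  have e : (1 / 2 : ℝ) * Real.exp (-(8 * (d - 1 : ℕ) * N * b)) * (1 / 2) =
      (1 / 4 : ℝ) * Real.exp (-(8 * (d - 1 : ℕ) * N * b)) := by ring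
  rw [e] at h
  exact h

end FreeEnergy

end EnergyVariance

end Summit.Ventures.YMGap.RobustBall
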